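import Summits.KontsevichZagierPeriods.KontsevichZagierPeriods.Theses.TerasomaMultiplication
import Summits.KontsevichZagierPeriods.KontsevichZagierPeriods.Theorems.CompleteModGammaSector.Negative.LoadBearing
import Literature.NumberTheory.Transcendental.KZRulesAssociator

/-!
# `CompleteModGammaSector` (stmt-KontsevichZagierPeriods-14233), line `Sketch` (card
# wronskian-transport): stub `stub_fuchsianTransport`

THE ALGEBRAIC HALF OF THE TRANSPORT ENGINE, in the formal period ring
`P = KZ.FormalPeriodRing = FormalRep ⧸ relations` (a commutative ring) with the Γ-ideal
`JΓ := Ideal.span (toFormalPeriod '' gammaHodgePairs)`. Pure commutative algebra (Cramer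
elimination against a period basis `K` plus Wronskian/`π` bookkeeping), CONDITIONAL on the two
seams it takes as hypotheses (`π`-cancellation and torsion-freeness modulo `JΓ`):

* with `A := F₁ K₂₁' − F₁' K₂₁`, `B := F₁ K₁₁' − F₁' K₁₁`, `W := K₁₁ K₂₁' − K₂₁ K₁₁'`, the anchors
  `F₀, F₀' ∈ JΓ` put the `a •`/`b •` terms of the two transported first integrals in `JΓ`, so
  `m • A, m • B ∈ JΓ`, hence `A, B ∈ JΓ` (torsion-freeness, `m ≠ 0`);
* the ring identity `F₁ W = K₁₁ A − K₂₁ B` gives `F₁ W ∈ JΓ`, and with the Wronskian congruence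
  `p • W ≡ q • ⟦π⟧ (mod JΓ)` one gets `q • (⟦π⟧ F₁) = p F₁ W − F₁ (p • W − q • ⟦π⟧) ∈ JΓ`;
* cancel `q ≠ 0` (torsion-freeness) and then `⟦π⟧` (`π`-cancellation): `F₁ ∈ JΓ`.
-/

noncomputable section

-- `Summit.KontsevichZagierPeriods.KontsevichZagierPeriods.…` is the tree's mandated layout (single-conjunct summit).
set_option linter.dupNamespace false

namespace Summit.KontsevichZagierPeriods.KontsevichZagierPeriods.CompleteModGammaSectorLine

open MeasureTheory Set
open Literature.NumberTheory.Transcendental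
open Literature.NumberTheory.Transcendental.KZ
open Summit.KontsevichZagierPeriods.CompleteModGammaSectorNegative (gammaHodgePairs sector)

/-- **Fuchsian transport modulo the Γ-ideal (engine, algebraic half; Cramer elimination +
Wronskian cancellation in the formal period ring `P`).** From `π`-cancellation and
torsion-freeness modulo the Γ-ideal `JΓ = Ideal.span (toFormalPeriod '' gammaHodgePairs)`
(hypotheses), anchors `F₀, F₀' ∈ JΓ`, the two transported first integrals (equalities in `P`)
and the Wronskian congruence `p • W ≡ q • ⟦π⟧ (mod JΓ)` with `q ≠ 0`, conclude `F₁ ∈ JΓ`.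
[cite: AndrewsAskeyRoy1999, Lemma 3.2.6] -/
theorem stub_fuchsianTransport :
    ∀ (F₀ F₀' F₁ F₁' K₁₀ K₁₀' K₂₀ K₂₀' K₁₁ K₁₁' K₂₁ K₂₁' : FormalPeriodRing) (m a b p q : ℤ),
      (∀ x : FormalPeriodRing, toFormalPeriod (of piRep) * x ∈ Ideal.span (toFormalPeriod '' gammaHodgePairs) →
        x ∈ Ideal.span (toFormalPeriod '' gammaHodgePairs)) →
      (∀ (k : ℤ) (x : FormalPeriodRing), k ≠ 0 → k • x ∈ Ideal.span (toFormalPeriod '' gammaHodgePairs) →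
        x ∈ Ideal.span (toFormalPeriod '' gammaHodgePairs)) →
      m ≠ 0 → q ≠ 0 →
      F₀ ∈ Ideal.span (toFormalPeriod '' gammaHodgePairs) →
      F₀' ∈ Ideal.span (toFormalPeriod '' gammaHodgePairs) →
      m • (F₁ * K₂₁' - F₁' * K₂₁) - a • (F₀ * K₂₀' - F₀' * K₂₀) = 0 →
      m • (F₁ * K₁₁' - F₁' * K₁₁) - b • (F₀ * K₁₀' - F₀' * K₁₀) = 0 →
      p • (K₁₁ * K₂₁' - K₂₁ * K₁₁') - q • toFormalPeriod (of piRep) ∈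
        Ideal.span (toFormalPeriod '' gammaHodgePairs) →
      F₁ ∈ Ideal.span (toFormalPeriod '' gammaHodgePairs) := by
  intro F₀ F₀' F₁ F₁' K₁₀ K₁₀' K₂₀ K₂₀' K₁₁ K₁₁' K₂₁ K₂₁' m a b p q hpi htf hm hq hF₀ hF₀' h₁ h₂ hW
  set J : Ideal FormalPeriodRing := Ideal.span (toFormalPeriod '' gammaHodgePairs)
  -- Step 1 (Cramer elimination): the two combinations `A`, `B` lie in `J`.
  have hA : F₁ * K₂₁' - F₁' * K₂₁ ∈ J := by
    refine htf m _ hm ?_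
    rw [sub_eq_zero] at h₁
    rw [h₁, zsmul_eq_mul]
    exact J.mul_mem_left _ (J.sub_mem (J.mul_mem_right _ hF₀) (J.mul_mem_right _ hF₀'))
  have hB : F₁ * K₁₁' - F₁' * K₁₁ ∈ J := by
    refine htf m _ hm ?_
    rw [sub_eq_zero] at h₂
    rw [h₂, zsmul_eq_mul]
    exact J.mul_mem_left _ (J.sub_mem (J.mul_mem_right _ hF₀) (J.mul_mem_right _ hF₀'))
  -- Step 2 (Wronskian): `F₁ * W = K₁₁ * A - K₂₁ * B ∈ J`.
  have hFW : F₁ * (K₁₁ * K₂₁' - K₂₁ * K₁₁') ∈ J := by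
    have key : F₁ * (K₁₁ * K₂₁' - K₂₁ * K₁₁') =
        K₁₁ * (F₁ * K₂₁' - F₁' * K₂₁) - K₂₁ * (F₁ * K₁₁' - F₁' * K₁₁) := by
      ring
    rw [key]
    exact J.sub_mem (J.mul_mem_left _ hA) (J.mul_mem_left _ hB)
  -- Step 3 (`π` bookkeeping): `q • (⟦π⟧ * F₁) = p * (F₁ * W) - F₁ * (p • W - q • ⟦π⟧) ∈ J`.
  have hqπF : q • (toFormalPeriod (of piRep) * F₁) ∈ J := by
    have key : q • (toFormalPeriod (of piRep) * F₁) =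
        (p : FormalPeriodRing) * (F₁ * (K₁₁ * K₂₁' - K₂₁ * K₁₁')) -
          F₁ * (p • (K₁₁ * K₂₁' - K₂₁ * K₁₁') - q • toFormalPeriod (of piRep)) := by
      simp only [zsmul_eq_mul]
      ring
    rw [key]
    exact J.sub_mem (J.mul_mem_left _ hFW) (J.mul_mem_left _ hW)
  -- Step 4: cancel `q ≠ 0` (torsion-freeness), then `⟦π⟧` (`π`-cancellation).
  exact hpi F₁ (htf q _ hq hqπF)

end Summit.KontsevichZagierPeriods.KontsevichZagierPeriods.CompleteModGammaSectorLine
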